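import Literature.Probability.RandomPlanarGeometry.HexSAWRotSurfaceYcGrowth
import HarnessLib

/-!
# The rotated strip thresholds are non-increasing: `y_{H+1} ≤ y_H`, with infimum `y†` (Beaton 2014, Corollary 10 — monotone half, weak form)

Topic `Literature/Probability/RandomPlanarGeometry` (continues the rotated capstone `HexSAWRotSurfaceFugacity.lean` — `HV.rotYT H`,
the threshold below which the `y`-weighted top class `W ↦ B^{→}_{H,W+1}(x_c; y) = HV.rotGFy ((rotStripV H (W+1)).erase wOut) H
(IsRotTopDart H) y` of Beaton's rotated strip `D(H, W)` stays bounded, with `HV.rotYdagger_le_rotYT : y† ≤ y_H` (`H ≥ 2`) and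
`HV.tendsto_rotYT : y_H → y†` — and `HV.rotQ1`, `shift` of `HexSAWRotSurfaceYcGrowth.lean`, whose `HV.rotLift` renders the classical one-row translation).
Source: N. R. Beaton, *The critical surface fugacity of self-avoiding walks on a rotated honeycomb lattice*, J. Phys. A 47
(2014) 075003, arXiv:1210.0274v3, §3.2, Corollary 10 (p. 15): "There exists a unique `y_T > 0` such that `ρ_T(y_T) = x_c :=
μ⁻¹`. The series (in `y`) `Â_T(x_c, y)`, `B̂_T(x_c, y)` and `Ĉ_T(x_c, y)` have radius of convergence `y_T`, and `y_T` decreases to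
the critical fugacity `y_c` as `T → ∞`.  The proof is identical to that of Corollary 8 in [BBdGDCG14]."  This file is the
rotated twin of `HexSAWStripSurfaceMonotone.lean` (the Duminil-Copin–Smirnov frame).

The mechanism is again an elementary, weight-preserving injection and not the printed route (Proposition 9's strict
growth-rate inequality): the translation `τ = shift (-1) 1` of the honeycomb lattice moves Beaton's height `ξ` by `−1` (one row
deeper) and the coordinate `X` along the start line by `+3` (one width unit), and sends `a⁻ = wOut` to `q₁ = HV.rotQ1`, the deep
neighbour of `a⁺`; so `γ ↦ a · a⁺ · τ(γ)` (`HV.rotLiftWalk`) maps the top-exit walks of `D(H, W+1)` injectively to top-exit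
walks of `D(H+1, W+2)` with two more vertices and the same number of top contacts.  Hence
`x_c² · B^{→}_{H,W+1}(x_c; y) ≤ B^{→}_{H+1,W+2}(x_c; y)` for every `y ≥ 0`, the boundedness sets are nested, and `y_{H+1} ≤ y_H`.

## Main statements (namespace `Literature.Probability.RandomPlanarGeometry.SAW.HV`, all proved)

* `rotTau`, `xi_rotTau`, `xX_rotTau`, `rotTau_wOut`, `rotLiftWalk`, `rotLiftWalk_injective`, `mwLen_rotLiftWalk`,
  `IsMidWalk.inner_rotLiftWalk`, **`IsMidWalk.rotLiftWalk`** (the lift of a walk of `D(H,W+1) ∖ {a⁻}` is a walk of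
  `D(H+1,W+2) ∖ {a⁻}`), `finalDart_rotLiftWalk`, `isRotTopDart_rotTau`, `topContacts_rotLiftWalk` (`1 ≤ H`);
* **`mul_rotGFy_top_le_succ`** — `x_c² · B^{→}_{H,W+1}(x_c; y) ≤ B^{→}_{H+1,W+2}(x_c; y)` (`H ≥ 1`, every `W`, every `y ≥ 0`);
* `sq_mul_rotStripBR_le_succ`, `sq_mul_iSup_rotStripBR_le_succ` — the case `y = 1`: `x_c² · sup_W B^{→}_{H,W} ≤ sup_W B^{→}_{H+1,W}`;
* `rotBddSet_succ_subset` (`H ≥ 1`); **`rotYT_succ_le`** — `y_{H+1} ≤ y_H` (`H ≥ 2`); `antitone_rotYT_add_two`;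
  `rotYT_add_two_mem_Icc`; **`iInf_rotYT_add_two`** — `⨅_H y_{H+2} = y†` (with `tendsto_rotYT`): non-increasing, infimum `y†`.

Status in print / scope: the printed clause is the STRICT decrease with the limit (Corollary 10, by the proof of BBdGDCG14
Corollary 8: Proposition 9's `μ_T(1,y) < μ_{T+1}(1,y)` and the common radius `ρ_T(y)` of the three series); neither the strict
form nor the common-radius statement is formalised here — the file proves the weak form `≤` by a different, injective
mechanism.  Label (lit-1 g14, 2026-08-23): CONSOLIDATION BY A DIFFERENT PROOF (weak half of Corollary 10's monotone clause) +
one XS lane inequality (`mul_rotGFy_top_le_succ`, `sq_mul_iSup_rotStripBR_le_succ`: no height comparison of `B_T` at fixed `x`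
is printed in Beaton / BBdGDCG / DCS / KP).  Lane «pcv-sawmu», a-p2 g9.
-/

noncomputable section

open Finset Filter Topology

namespace Literature.Probability.RandomPlanarGeometry.SAW.HV

variable {V : Finset HV} {P : List HV}

/-! ### The translation `τ`: one row deeper, one width unit along the start line -/

/-- `τ = shift (-1) 1`: `(x₀, x₁, b) ↦ (x₀ − 1, x₁ + 1, b)`. [cite: Beaton2014RotatedHoneycomb, §2.2 (the domain D_{T,L}, arXiv v3 p. 5: heights and the line through the start edge)] -/
def rotTau : hvGraph ≃g hvGraph := shift (-1) 1

/-- `τ` in coordinates. [cite: Beaton2014RotatedHoneycomb, §2.2 (D_{T,L}, arXiv v3 p. 5)] -/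
@[simp] theorem rotTau_apply (v : HV) : rotTau v = (v.1 + -1, v.2.1 + 1, v.2.2) := rfl

/-- `τ` lowers Beaton's height coordinate `ξ` by one: `ξ(τ v) = ξ(v) − 1`. [cite: Beaton2014RotatedHoneycomb, §2.2 (arXiv v3 p. 5: the height of a vertex in D_{T,L})] -/
theorem xi_rotTau (v : HV) : xi (rotTau v) = xi v - 1 := by
  rw [rotTau, xi_shift]; ring

/-- `τ` moves the coordinate along the start line by one width unit: `X(τ v) = X(v) + 3`. [cite: Beaton2014RotatedHoneycomb, §2.2 (arXiv v3 p. 5: the width of D_{T,L} is the number of columns of cells)] -/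
theorem xX_rotTau (v : HV) : xX (rotTau v) = xX v + 3 := by
  obtain ⟨a, b, c⟩ := v
  simp only [xX, rotTau_apply, bit]
  ring

/-- `τ(a⁻) = q₁`, the deep neighbour of `a⁺`. [cite: Beaton2014RotatedHoneycomb, §2 (Fig. 1(b), arXiv v3 p. 2: the rotated frame)] -/
theorem rotTau_wOut : rotTau wOut = rotQ1 := by
  simp [wOut, rotQ1]

/-- `a⁺ ∼ τ(a⁻)`. [cite: Beaton2014RotatedHoneycomb, §2 (Fig. 1(b), arXiv v3 p. 2)] -/
theorem adj_hvOrigin_rotTau_wOut : hvGraph.Adj hvOrigin (rotTau wOut) := by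
  rw [rotTau_wOut]; exact adj_hvOrigin_rotQ1

/-! ### The lift `γ ↦ a · a⁺ · τ(γ)` -/

/-- **The rotated lift** on vertex lists: `[a⁻, a⁺, v₁, …, u] ↦ [a⁻, a⁺, τ a⁻ = q₁, τ a⁺, τ v₁, …, τ u]`.
[cite: Beaton2014RotatedHoneycomb, Proposition 7 (arXiv v3 p. 11; the classical one-row translation behind "μ(y) = μ for y ≤ 1", [18] = Whittington 1975, invoked p. 14, not displayed; `rotLift`/`rotLiftWalk` are the lane's rendering); lane: the same translation inside the strips D(H, W)] -/
def rotLiftWalk (P : List HV) : List HV := wOut :: hvOrigin :: P.map rotTau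

/-- The lift is injective. [cite: Beaton2014RotatedHoneycomb, Proposition 7 (arXiv v3 p. 11; the classical one-row translation behind "μ(y) = μ for y ≤ 1", [18] = Whittington 1975, invoked p. 14, not displayed; `rotLift`/`rotLiftWalk` are the lane's rendering)] -/
theorem rotLiftWalk_injective : Function.Injective rotLiftWalk := by
  intro P Q h
  simp only [rotLiftWalk, List.cons.injEq, true_and] at h
  exact List.map_injective_iff.2 rotTau.injective h

/-- The lift visits two more vertices. [cite: Beaton2014RotatedHoneycomb, Proposition 7 (arXiv v3 p. 11; the classical one-row translation behind "μ(y) = μ for y ≤ 1", [18] = Whittington 1975, invoked p. 14, not displayed; `rotLift`/`rotLiftWalk` are the lane's rendering)] -/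
theorem mwLen_rotLiftWalk {P : List HV} (h : 2 ≤ P.length) : mwLen (rotLiftWalk P) = mwLen P + 2 := by
  simp only [mwLen, rotLiftWalk, List.length_cons, List.length_map]
  omega

/-- The lift of `w :: (l ++ [u])` in `cons`/`append` form. [cite: Beaton2014RotatedHoneycomb, Proposition 7 (arXiv v3 p. 11; the classical one-row translation behind "μ(y) = μ for y ≤ 1", [18] = Whittington 1975, invoked p. 14, not displayed; `rotLift`/`rotLiftWalk` are the lane's rendering)] -/
theorem rotLiftWalk_cons_append (l : List HV) (u : HV) :
    rotLiftWalk (wOut :: (l ++ [u])) = wOut :: ((hvOrigin :: rotTau wOut :: l.map rotTau) ++ [rotTau u]) := by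
  simp [rotLiftWalk]

/-- The visited vertices of the lift: `a⁺`, `q₁`, then the translated visited vertices of `γ`. [cite: Beaton2014RotatedHoneycomb, Proposition 7 (arXiv v3 p. 11; the classical one-row translation behind "μ(y) = μ for y ≤ 1", [18] = Whittington 1975, invoked p. 14, not displayed; `rotLift`/`rotLiftWalk` are the lane's rendering)] -/
theorem IsMidWalk.inner_rotLiftWalk (h : IsMidWalk V P) :
    HV.inner (rotLiftWalk P) = hvOrigin :: rotTau wOut :: (HV.inner P).map rotTau := by
  obtain ⟨Q, rfl⟩ := h.exists_eq_cons
  simp [HV.inner, rotLiftWalk, List.map_dropLast]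

/-- **The lift translates the final half-edge**: `finalDart (rotLiftWalk γ) = τ (finalDart γ)`. [cite: Beaton2014RotatedHoneycomb, §2.2 (arXiv v3 p. 5: the boundary mid-edges of D_{T,L})] -/
theorem finalDart_rotLiftWalk (h : IsMidWalk V P) :
    finalDart (rotLiftWalk P) = (rotTau (finalDart P).1, rotTau (finalDart P).2) := by
  rcases h.trivial_or_exists with rfl | ⟨l, u, hl, rfl⟩
  · rfl
  · rw [rotLiftWalk_cons_append, finalDart_cons_append (List.cons_ne_nil _ _), finalDart_cons_append hl]
    simp only [Prod.mk.injEq, and_true]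
    rw [List.getLast_cons (by simp), List.getLast_cons (by simp [hl]), List.getLast_map]

/-- **The lift keeps the top class**: a top exit of `D(H, ·)` (heights `H → H+1`) goes to a top exit of `D(H+1, ·)`.
[cite: Beaton2014RotatedHoneycomb, §2.2 (arXiv v3 p. 5: the top boundary β^± of D_{T,L})] -/
theorem isRotTopDart_rotTau {H : ℕ} {d : HV × HV} (h : IsRotTopDart H d) :
    IsRotTopDart (H + 1) (rotTau d.1, rotTau d.2) := by
  obtain ⟨h1, h2⟩ := h
  refine ⟨?_, ?_⟩ <;> simp only [xi_rotTau] <;> push_cast <;> omega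

/-- **The lift keeps the number of top contacts** (`H ≥ 1`): the new visited vertices `a⁺`, `q₁` have heights `0`, `1`, and
`τ` moves the top row `ξ = −H` of `D(H, ·)` to the top row `ξ = −(H+1)` of `D(H+1, ·)`.
[cite: Beaton2014RotatedHoneycomb, §2.4 (arXiv v3 p. 8: "we associate the surface fugacity y with vertices on the β boundary of D_{T,L}")] -/
theorem topContacts_rotLiftWalk {H : ℕ} (hH : 1 ≤ H) (h : IsMidWalk V P) :
    topContacts (H + 1) (rotLiftWalk P) = topContacts H P := by
  rw [topContacts, topContacts, h.inner_rotLiftWalk]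
  have hO : ¬ (xi hvOrigin = -((H + 1 : ℕ) : ℤ)) := by rw [xi_hvOrigin]; push_cast; omega
  have hq : ¬ (xi (rotTau wOut) = -((H + 1 : ℕ) : ℤ)) := by rw [xi_rotTau, xi_wOut]; push_cast; omega
  rw [List.countP_cons_of_neg (by simpa using hO), List.countP_cons_of_neg (by simpa using hq), List.countP_map]
  refine List.countP_congr fun v _ => ?_
  simp only [Function.comp_apply, xi_rotTau, decide_eq_true_eq]
  push_cast
  omega

/-- Dropping the last two entries commutes with a long enough `cons` (list bookkeeping). [folklore] -/
private theorem getLast?_dropLast_dropLast_cons' {α : Type*} (a : α) {l : List α} (h : 3 ≤ l.length) :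
    (a :: l).dropLast.dropLast.getLast? = l.dropLast.dropLast.getLast? := by
  have h1 : l ≠ [] := by rintro rfl; simp at h
  have h2 : l.dropLast ≠ [] := by
    intro h'; have := congrArg List.length h'; simp at this; omega
  have h3 : l.dropLast.dropLast ≠ [] := by
    intro h'; have := congrArg List.length h'; simp at this; omega
  rw [List.dropLast_cons_of_ne_nil h1, List.dropLast_cons_of_ne_nil h2]
  obtain ⟨m, b, hm⟩ := (List.eq_nil_or_concat l.dropLast.dropLast).resolve_left h3
  rw [hm, List.concat_eq_append, ← List.cons_append, List.getLast?_concat, List.getLast?_concat]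

/-- **The lift of a walk of `D(H, W+1) ∖ {a⁻}` is a walk of `D(H+1, W+2) ∖ {a⁻}`.**
[cite: Beaton2014RotatedHoneycomb, §2.2 (D_{T,L}, arXiv v3 p. 5) and Proposition 7 (arXiv v3 p. 11; the classical one-row translation behind "μ(y) = μ for y ≤ 1", [18] = Whittington 1975, invoked p. 14, not displayed; `rotLift`/`rotLiftWalk` are the lane's rendering)] -/
theorem IsMidWalk.rotLiftWalk {H Wd : ℕ} (h : IsMidWalk ((rotStripV H (Wd + 1)).erase wOut) P) :
    IsMidWalk ((rotStripV (H + 1) (Wd + 2)).erase wOut) (rotLiftWalk P) := by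
  have hcm : (P.map rotTau).IsChain hvGraph.Adj :=
    (List.isChain_map rotTau).2 (h.1.imp fun a b hab => (rotTau.map_adj_iff).2 hab)
  have hin := h.inner_rotLiftWalk
  -- heights of the old visited vertices: `ξ ≤ 0`, and `a⁻` is not among them
  have hxi : ∀ x ∈ HV.inner P, xi x ≤ 0 ∧ x ≠ wOut := by
    intro x hx
    have hx' := h.2.2.2.1 x hx
    rw [mem_erase, mem_rotStripV_iff] at hx'
    obtain ⟨hne, hx' | hx' | hx'⟩ := hx'
    · exact absurd hx' hne
    · subst hx'; exact ⟨by rw [xi_hvOrigin], hne⟩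
    · exact ⟨by omega, hne⟩
  have hq1 : rotTau wOut ∈ (rotStripV (H + 1) (Wd + 2)).erase wOut := by
    rw [mem_erase, mem_rotStripV_iff, rotTau_wOut, xi_rotQ1]
    refine ⟨by decide, Or.inr (Or.inr ⟨by norm_num, by push_cast; omega, ?_⟩)⟩
    have : xX rotQ1 = 5 := by simp [xX, rotQ1]
    rw [this, abs_lt]; push_cast; constructor <;> linarith
  obtain ⟨Q, rfl⟩ := h.exists_eq_cons
  refine ⟨?_, rfl, rfl, ?_, ?_, ?_⟩
  · -- chain
    simp only [rotLiftWalk, List.map_cons, List.isChain_cons_cons] at hcm ⊢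
    exact ⟨adj_wOut_hvOrigin, adj_hvOrigin_rotTau_wOut, hcm⟩
  · -- inside `D(H+1, W+2) ∖ {a⁻}`
    rw [hin]
    intro x hx
    rcases List.mem_cons.1 hx with rfl | hx
    · exact mem_erase.2 ⟨by decide, hvOrigin_mem_rotStripV _ _⟩
    rcases List.mem_cons.1 hx with rfl | hx
    · exact hq1
    obtain ⟨u, hu, rfl⟩ := List.mem_map.1 hx
    have hu' := h.2.2.2.1 u hu
    rw [mem_erase, mem_rotStripV_iff] at hu' ⊢
    obtain ⟨hne, hu' | hu' | ⟨h1, h2, h3⟩⟩ := hu'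
    · exact absurd hu' hne
    · subst hu'
      refine ⟨?_, Or.inr (Or.inr ?_)⟩
      · intro heq; have := congrArg xi heq; rw [xi_rotTau, xi_hvOrigin, xi_wOut] at this; omega
      rw [xi_rotTau, xi_hvOrigin, xX_rotTau, xX_hvOrigin]
      refine ⟨by norm_num, by push_cast; omega, ?_⟩
      rw [abs_lt]; push_cast; constructor <;> linarith
    · refine ⟨?_, Or.inr (Or.inr ⟨?_, ?_, ?_⟩)⟩
      · intro heq; have := congrArg xi heq; rw [xi_rotTau, xi_wOut] at this; omega
      · rw [xi_rotTau]; omega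
      · rw [xi_rotTau]; push_cast; omega
      · rw [xX_rotTau]
        have := abs_lt.1 h3
        rw [abs_lt]; push_cast at this ⊢; constructor <;> linarith
  · -- self-avoiding
    rw [hin, List.nodup_cons, List.nodup_cons]
    refine ⟨?_, ?_, h.2.2.2.2.1.map rotTau.injective⟩
    · intro hO
      rcases List.mem_cons.1 hO with hO | hO
      · have := congrArg xi hO; rw [xi_hvOrigin, xi_rotTau, xi_wOut] at this; omega
      obtain ⟨u, hu, hOu⟩ := List.mem_map.1 hO
      have h1 := (hxi u hu).1
      have h2 := congrArg xi hOu
      rw [xi_rotTau, xi_hvOrigin] at h2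
      omega
    · intro hw
      obtain ⟨u, hu, hwu⟩ := List.mem_map.1 hw
      exact (hxi u hu).2 (rotTau.injective hwu)
  · -- the final half-edge does not retrace
    have hl := h.2.2.2.2.2
    rcases Q with _ | ⟨e, Q⟩
    · simp [rotLiftWalk, hvOrigin, wOut]
    · have hne : ((wOut :: hvOrigin :: e :: Q).map rotTau) ≠ [] := by simp
      have hlen : 3 ≤ ((wOut :: hvOrigin :: e :: Q).map rotTau).length := by simp
      rw [rotLiftWalk, getLast?_dropLast_dropLast_cons' wOut (by simp), getLast?_dropLast_dropLast_cons' hvOrigin hlen,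
        List.getLast?_cons_cons, List.getLast?_cons_of_ne_nil hne, ← List.map_dropLast, ← List.map_dropLast,
        List.getLast?_map, List.getLast?_map]
      exact fun heq => hl (Option.map_injective rotTau.injective heq)

/-! ### `x_c² · B^{→}_{H,W+1}(x_c; y) ≤ B^{→}_{H+1,W+2}(x_c; y)` and the monotonicity of the thresholds -/

/-- **`x_c² · B^{→}_{H,W+1}(x_c; y) ≤ B^{→}_{H+1,W+2}(x_c; y)`** for `H ≥ 1`, every `W` and every `y ≥ 0`: the rotated lift is a
weight-`x_c²`, contact-preserving injection of the top-exit walks of `D(H, W+1)` into those of `D(H+1, W+2)`.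
[cite: Beaton2014RotatedHoneycomb, §2.4 (B_{T,L}(x, y), arXiv v3 p. 8) and §3.2 Corollary 10 (p. 15: "y_T decreases"); lane: injective proof of the weak monotonicity] -/
theorem mul_rotGFy_top_le_succ {H : ℕ} (hH : 1 ≤ H) (Wd : ℕ) {y : ℝ} (hy : 0 ≤ y) :
    hexCriticalFugacity ^ 2 * rotGFy ((rotStripV H (Wd + 1)).erase wOut) H (IsRotTopDart H) y ≤
      rotGFy ((rotStripV (H + 1) (Wd + 2)).erase wOut) (H + 1) (IsRotTopDart (H + 1)) y := by
  classical
  have hx : 0 < hexCriticalFugacity := hexCriticalFugacity_pos_lt_one.1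
  set F := (midWalks ((rotStripV H (Wd + 1)).erase wOut)).filter (fun P => IsRotTopDart H (finalDart P)) with hF
  have himg : F.image rotLiftWalk ⊆
      (midWalks ((rotStripV (H + 1) (Wd + 2)).erase wOut)).filter (fun P => IsRotTopDart (H + 1) (finalDart P)) := by
    intro P' hP'
    obtain ⟨P, hP, rfl⟩ := mem_image.1 hP'
    rw [mem_filter, mem_midWalks_iff] at hP ⊢
    refine ⟨hP.1.rotLiftWalk, ?_⟩
    rw [finalDart_rotLiftWalk hP.1]
    exact isRotTopDart_rotTau hP.2
  calc hexCriticalFugacity ^ 2 * rotGFy ((rotStripV H (Wd + 1)).erase wOut) H (IsRotTopDart H) y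
      = ∑ P ∈ F, hexCriticalFugacity ^ (mwLen P + 2) * y ^ topContacts H P := by
        rw [rotGFy, ← hF, mul_sum]
        refine sum_congr rfl fun P _ => ?_
        rw [pow_add]; ring
    _ = ∑ P' ∈ F.image rotLiftWalk, hexCriticalFugacity ^ mwLen P' * y ^ topContacts (H + 1) P' := by
        rw [sum_image fun _ _ _ _ h => rotLiftWalk_injective h]
        refine sum_congr rfl fun P hP => ?_
        have hP' := mem_midWalks_iff.1 (mem_filter.1 hP).1
        rw [mwLen_rotLiftWalk hP'.two_le_length, topContacts_rotLiftWalk hH hP']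
    _ ≤ rotGFy ((rotStripV (H + 1) (Wd + 2)).erase wOut) (H + 1) (IsRotTopDart (H + 1)) y :=
        sum_le_sum_of_subset_of_nonneg himg fun _ _ _ => mul_nonneg (pow_nonneg hx.le _) (pow_nonneg hy _)

/-- **`x_c² · B^{⊥,→}_{H,W+1}(x_c) ≤ B^{⊥,→}_{H+1,W+2}(x_c)`** (`H ≥ 1`): the case `y = 1`.
[cite: Beaton2014RotatedHoneycomb, §2.2 (B_{T,L}(x), arXiv v3 p. 5); lane: injective lower companion, not stated in print] -/
theorem sq_mul_rotStripBR_le_succ {H : ℕ} (hH : 1 ≤ H) (Wd : ℕ) :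
    hexCriticalFugacity ^ 2 * rotStripBR H (Wd + 1) ≤ rotStripBR (H + 1) (Wd + 2) := by
  have h := mul_rotGFy_top_le_succ hH Wd zero_le_one
  rwa [rotGFy_one, rotGFy_one, ← rotStripBR_eq_rotGF, ← rotStripBR_eq_rotGF] at h

/-- **`x_c² · sup_W B^{⊥,→}_{H,W}(x_c) ≤ sup_W B^{⊥,→}_{H+1,W}(x_c)`** (`H ≥ 1`): the critical top classes of consecutive rotated
strips compare within the factor `x_c² = 1/(2 + √2)` from below. [cite: Beaton2014RotatedHoneycomb, §4 (arXiv v3 p. 16: B_T := lim_L B_{T,L}, "A^O_{T,L}, A^I_{T,L}, B_{T,L} and P_{T,L} are increasing with L"); lane: injective lower companion, not stated in print] -/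
theorem sq_mul_iSup_rotStripBR_le_succ {H : ℕ} (hH : 1 ≤ H) :
    hexCriticalFugacity ^ 2 * (⨆ Wd : ℕ, rotStripBR H Wd) ≤ ⨆ Wd : ℕ, rotStripBR (H + 1) Wd := by
  have hx2 : 0 < hexCriticalFugacity ^ 2 := pow_pos hexCriticalFugacity_pos_lt_one.1 2
  rw [mul_comm, ← le_div_iff₀ hx2]
  refine ciSup_le fun Wd => ?_
  rw [le_div_iff₀ hx2, mul_comm]
  calc hexCriticalFugacity ^ 2 * rotStripBR H Wd
      ≤ hexCriticalFugacity ^ 2 * rotStripBR H (Wd + 1) :=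
        mul_le_mul_of_nonneg_left (rotStripBR_mono_width (Nat.le_succ Wd)) hx2.le
    _ ≤ rotStripBR (H + 1) (Wd + 2) := sq_mul_rotStripBR_le_succ hH Wd
    _ ≤ ⨆ Wd : ℕ, rotStripBR (H + 1) Wd := rotStripBR_le_iSup (by omega) (Wd + 2)

/-- **The boundedness sets are nested**: `rotBddSet (H+1) ⊆ rotBddSet H` (`H ≥ 1`) — if `W ↦ B^{→}_{H+1,W+1}(x_c; y)` is bounded,
so is `W ↦ B^{→}_{H,W+1}(x_c; y) ≤ x_c⁻² B^{→}_{H+1,W+2}(x_c; y)`.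
[cite: Beaton2014RotatedHoneycomb, §3.2, Corollary 10 (arXiv v3 p. 15: "y_T decreases to the critical fugacity y_c"); lane: weak form by the lift] -/
theorem rotBddSet_succ_subset {H : ℕ} (hH : 1 ≤ H) : rotBddSet (H + 1) ⊆ rotBddSet H := by
  have hx : 0 < hexCriticalFugacity := hexCriticalFugacity_pos_lt_one.1
  rintro y ⟨hy, ⟨K, hK⟩⟩
  refine ⟨hy, ⟨K / hexCriticalFugacity ^ 2, ?_⟩⟩
  rintro _ ⟨Wd, rfl⟩
  have h1 := mul_rotGFy_top_le_succ hH Wd hy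
  have h2 : rotGFy ((rotStripV (H + 1) (Wd + 1 + 1)).erase wOut) (H + 1) (IsRotTopDart (H + 1)) y ≤ K := hK ⟨Wd + 1, rfl⟩
  rw [le_div_iff₀ (pow_pos hx 2), mul_comm]
  exact h1.trans h2

/-- The boundedness set of `D(H+1, ·)` is nonempty (it contains `(0, y†)`). [cite: Beaton2014RotatedHoneycomb, §4, Lemma 12 (arXiv v3 p. 17: boundedness below y†)] -/
theorem rotBddSet_succ_nonempty (H : ℕ) : (rotBddSet (H + 1)).Nonempty :=
  ⟨rotYdagger / 2, mem_rotBddSet_of_lt (by omega) (half_pos rotYdagger_pos) (half_lt_self rotYdagger_pos)⟩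

/-- **`y_{H+1} ≤ y_H`** (`H ≥ 2`): the rotated strip thresholds are non-increasing (weak form of Corollary 10's printed strict
decrease). [cite: Beaton2014RotatedHoneycomb, §3.2, Corollary 10 (arXiv v3 p. 15: "y_T decreases to the critical fugacity y_c as T → ∞"); lane: weak form, by the lift injection instead of Proposition 9] -/
theorem rotYT_succ_le {H : ℕ} (hH : 2 ≤ H) : rotYT (H + 1) ≤ rotYT H :=
  csSup_le_csSup (rotBddSet_bddAbove hH) (rotBddSet_succ_nonempty H) (rotBddSet_succ_subset (by omega))

/-- `H ↦ y_{H+2}` is antitone. [cite: Beaton2014RotatedHoneycomb, §3.2, Corollary 10 (arXiv v3 p. 15)] -/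
theorem antitone_rotYT_add_two : Antitone fun H : ℕ => rotYT (H + 2) :=
  antitone_nat_of_succ_le fun H => rotYT_succ_le (by omega)

/-- `y_{H+2} ≤ y_2` for every `H`. [cite: Beaton2014RotatedHoneycomb, §3.2, Corollary 10 (arXiv v3 p. 15)] -/
theorem rotYT_add_two_le_rotYT_two (H : ℕ) : rotYT (H + 2) ≤ rotYT 2 :=
  antitone_rotYT_add_two (Nat.zero_le H)

/-- `y† ≤ y_{H+2} ≤ y_2` for every `H`. [cite: Beaton2014RotatedHoneycomb, §3.2, Corollary 10 (arXiv v3 p. 15) with §4, Lemma 12 (p. 17: y† ≤ y_T)] -/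
theorem rotYT_add_two_mem_Icc (H : ℕ) : rotYT (H + 2) ∈ Set.Icc rotYdagger (rotYT 2) :=
  ⟨rotYdagger_le_rotYT (by omega), rotYT_add_two_le_rotYT_two H⟩

/-- **`⨅_H y_{H+2} = y†`**: the rotated thresholds are non-increasing with infimum `y†` (antitone, bounded below by `y†`, with
limit `y†` — the rotated capstone's `tendsto_rotYT`). [cite: Beaton2014RotatedHoneycomb, §3.2, Corollary 10 (arXiv v3 p. 15: "y_T decreases to the critical fugacity y_c") and Theorem 1 (p. 2: the value y_c = y†)] -/
theorem iInf_rotYT_add_two : (⨅ H : ℕ, rotYT (H + 2)) = rotYdagger := by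
  have hbdd : BddBelow (Set.range fun H : ℕ => rotYT (H + 2)) :=
    ⟨rotYdagger, by rintro _ ⟨H, rfl⟩; exact rotYdagger_le_rotYT (by omega)⟩
  exact tendsto_nhds_unique (tendsto_atTop_ciInf antitone_rotYT_add_two hbdd)
    (tendsto_rotYT.comp (tendsto_add_atTop_nat 2))

/-- Every threshold dominates the infimum. [cite: Beaton2014RotatedHoneycomb, §3.2, Corollary 10 (arXiv v3 p. 15)] -/
theorem iInf_rotYT_add_two_le (H : ℕ) : (⨅ H : ℕ, rotYT (H + 2)) ≤ rotYT (H + 2) := by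
  rw [iInf_rotYT_add_two]
  exact rotYdagger_le_rotYT (by omega)

end Literature.Probability.RandomPlanarGeometry.SAW.HV
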